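import Literature.NumberTheory.Automorphic.Liu2021.AppendixC.AlbaneseFunctorial
import Literature.AlgebraicGeometry.Motives.ChowCorrespondences
import Literature.AlgebraicGeometry.Motives.TateAbelianFiniteSteps
import HarnessLib

/-!
# Liu 2021, §2 «Albanese variety» (print pp. 22–33): the statements 2.1–2.12 AS PRINTED — carpet (statements only)

Source: Y. Liu, *Fourier–Jacobi cycles and arithmetic relative trace formula*, Camb. J. Math. **9** (2021) 1–147 [Liu2021],
§2 (print pp. 22–33; TeX of record `FJcycle.tex` md5 6db49a74…, `\label{ss:a}` l. 1160–1561: §2.1 «Albanese variety and its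
polarization» l. 1168–1421, §2.2 «Picard motives via almost ample divisors» l. 1424–1561).  Standing setting (l. 1165): `k` a
field, `Sch_{/k}`; §2.2 (l. 1427): `k` of characteristic zero, `X` proper smooth of pure dimension `d ≥ 1`.

STATEMENT-ONLY CARPET (squad TL «Liu FJ∕418», seat TL-t08; TYPER LINT RULE): statements only, no proofs.  The tree ALREADY types
Def. 2.1 (1), Prop. 2.2, Def. 2.3 and (the uses of) Lem. 2.4 — cited by name in the INDEX, not restated.  The new items are
predicates on ONE in-file hypothesis structure `Sec2Data X d 𝔇` (TL-plan ruling 01:59:30Z: in-file interfaces), whose REAL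
fields are Mathlib ∕ tree objects — `X : SchemeOver k` (★ `Motives.SchemeOver` = `Over (Spec k)`) proper and smooth of relative
dimension `d` (Mathlib `IsProper`, `SmoothOfRelativeDimension`), the Albanese datum `alb : ★ AppendixC.Albanese X` (`∇X`, `Alb_X`,
`α_X`, corepresentability), morphisms of ★ `Motives.AbelianVariety k` (`[n]_A = n • 𝟙 A` in the ★ preadditive structure), points
★ `AbelianVariety.Points` ∕ ★ `AlgPoints.map`, correspondences ★ `Motives.Corr X X d = CH_d(X × X)_ℚ` — and whose ⟨CARRIER⟩
fields posit what Mathlib ∕ the tree lack for abelian VARIETIES over a field and for divisors on a non-integral `X`: the dual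
`A ↦ A^∨` with `f ↦ f^∨`, «symmetric», «polarization» (`DualityCarriers k`; the tree's honest scheme-theoretic notions are ★
`AbelianSchemes.DualPair` ∕ ★ `AbelianSchemes.Polarization`, over `AbelianSchemeOver S`, a different carrier), divisors on `X`
with `nD`, rational equivalence, `|D|` base-point free, `φ_D` generically finite onto its image, `deg D^{dim X}` per component,
«`k′` splits `X`», the morphisms `f_x` of Def. 2.1 (3), the value `Σ_{A′}(c₁(L_a).f_{x*}(D^{dim X−1}))`, the homomorphisms
`θ_{f,D}`, the correspondence `e_{X,D}` and the action `cl*_dR` on `H^i_dR(X/k)`.  Every printed statement is a predicate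
`def … (S : Sec2Data X d 𝔇) : Prop` (class **P**, verbatim reading with locator); NOTHING IS ASSERTED; a consumer takes
`(h : S.Prop25)` etc. as hypotheses, never `∀ S`.  Class **D** = definitions read off the print with bodies (`CompPoint`,
`IsAlmostAmple`, `thetaX`, `AlbHom`).

## INDEX (print numbering = TeX counter; p. = journal page of the item's first line)

| item | content | Lean |
|---|---|---|
| **Def. 2.1 (1)** (p. 22; l. 1174) | `∇X`, `∇u` | ★ `AppendixC.Nabla` (`AppendixC/Glue`), ★ `Nabla.map` (`AppendixC/AlbaneseFunctorial`) |
| **Def. 2.1 (2)** (p. 22; l. 1176) | «`k′` splits `X`»; `X(π₀(X_{k′}))` | carrier `Sec2Data.Splits`; REAL `CompPoint` (D) |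
| **Def. 2.1 (3)** (p. 22; l. 1178–1182) | `f_x : X_{k′} → Y_{k′}` | carrier `Sec2Data.fx` |
| **Prop. 2.2** (p. 23; l. 1190–1192) + **Def. 2.3** (p. 23; l. 1202–1208) | `\underline{Alb}_X` corepresentable; `Alb_X`, `α_X`, `Alb_u` | ★ `AppendixC.Albanese` (`Glue` :249: `Alb`, `α`, `desc`∕`fac`∕`uniq`), ★ `Albanese.map` + `α_map` (= «`Alb_u ∘ α_Y = α_X ∘ ∇u`»), existence ★ `Albanese.nonempty_of_isProjectiveOver` ∕ `nonempty_of_numberField` (`Liu2021/AlbaneseExistence`) |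
| **Lem. 2.4** (p. 23; l. 1210–1217) | (1) `H¹_{B,τ}(Alb_X, ℚ) ≅ H¹_{B,τ}(X, ℚ)`; (2) `H¹_ét((Alb_X)_{k^ac}, ℚ_ℓ) ≅ H¹_ét(X_{k^ac}, ℚ_ℓ)` Galois-equivariantly | (1) ★ `albanese_bettiOne_pullback_bijective` (`Liu2021/Lemma24BettiAlbanese`, AS PRINTED with its proof) + ★ `AlbaneseH1ComparisonFamily.cmpEquiv` (`AppendixC/AlbaneseH1Comparison`) — cited, not restated; (2) `Lem24_2` (Alb side REAL: `Module.Dual ℚ_ℓ V_ℓ(Alb_X)` with ★ `AbelianVariety.rationalTateRep … .dual`, as ★ `AppendixC/EtaleH1Tower` reads `H¹_ét`; `X` side carriers `H1et`, `galH1et`, `etalePull`) |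
| **Prop. 2.5** (p. 24; l. 1245–1255) | `θ_{f,D} : A^∨ → A`, unique with `θ_{f,D}(a) = Σ_{A′}(c₁(L_a).f_{x*}(D^{dim X−1}))`; symmetric; rational class; `θ_{f,nD} = [n^{dim X−1}]_A ∘ θ_{f,D}` | `Prop25_formula`, `Prop25_unique`, `Prop25_symm`, `Prop25_ratEquiv`, `Prop25_smul` (carriers `theta`, `thetaValue`) |
| l. 1326–1329 (p. 26) | `θ_{X,D} := θ_{α_X,D} : Alb_X^∨ → Alb_X` | `thetaX` (D) |
| **Rem. 2.6** (p. 26; l. 1331–1333) | `dim X = 1`: `θ_{X,D}` = canonical polarization of the Jacobian, iso, independent of `D` | `Rem26` |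
| **Prop. 2.7** (p. 27; l. 1337–1343) | `[deg u]_{Alb_X} ∘ θ_{X,D} = Alb_u ∘ θ_{Y,u*D} ∘ Alb_u^∨` | `Sec2PairData.Prop27` (carriers `pullDiv`, `degEndo`, relation `GenFiniteDominant`) |
| **Def. 2.8** (p. 28; l. 1377–1379) | almost ample divisor | `IsAlmostAmple` (D; carriers `BasePointFree`, `GenFiniteOntoImage`) |
| **Prop. 2.9** (p. 28; l. 1382–1384) | char 0, `D` almost ample ⇒ `θ_{X,D}` is a polarization | `Prop29` |
| **Rem. 2.10** (p. 29; l. 1415–1417) | `deg D^{dim X} > 0` on every irreducible component | `Rem210` (carrier `degTop`) |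
| Rem. 2.11 (p. 29; l. 1419–1421) | open question (algebraic proof? arbitrary `k`?) | INDEX note only, no token |
| §2.2 set-up (p. 29–30; l. 1427–1445) | `θ`, `ϑ`, `n`, `β`, `𝒫`, `E_{X,D}`, `e_{X,D} := E_{X,D}/(n (deg D^d)²) ∈ CH^d(X×X)_ℚ`, `cl*_dR` | carriers `picardCorrespondence` (`e_{X,D}`, in REAL ★ `Corr X X d`), `HdR`, `clStar` |
| **Prop. 2.12** (p. 30; l. 1448–1459) | (1) `cl*_dR(e_{X,D})` = projection onto `H¹_dR`; (2) `u*D` almost ample, `(id_Y × u)_* e_{Y,u*D} = (u × id_X)^* e_{X,D}` | `Prop212_1`; `Sec2PairData.Prop212_2` (carriers `pushIdProd`, `pullProdId`) |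

Specialisations (documented, not hidden): `X` is taken smooth of PURE relative dimension `d` (Liu §2.1 allows any proper smooth `X`;
§2.2 assumes pure dimension `d ≥ 1`; the Shimura varieties of §4 are pure of dimension `n − 1`); in Prop. 2.7 ∕ 2.12 (2) `Y` is
taken of the same pure dimension `d` (forced by «generically finite dominant»).  `dim X − 1` is `d - 1 : ℕ`, guarded by `1 ≤ d`.
HC_CM is proved only modulo the 7 printed citations (2 remaining: hLiu418, h413) until rung 0 closes; nothing asserted here.

## References
* [Liu2021] Y. Liu, Camb. J. Math. 9 (2021) 1–147, §2 pp. 22–33 (TeX l. 1160–1561); [Mur90] J. Murre, *On the motive of an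
  algebraic surface*, J. reine angew. Math. 409 (1990), §2–§3 (the hyperplane-section case of Prop. 2.5 and of `e_{X,D}`);
  [Ser59] J.-P. Serre, *Morphismes universels et variété d'Albanese* (1958∕59); [Wit08] O. Wittenberg, App. A; [Ful98] W. Fulton,
  *Intersection Theory*, Prop. 1.7, Ex. 8.1.7 [Fulton1998]; D. Mumford, *Abelian Varieties* §8, §13 (dual, polarizations).
-/

noncomputable section

open CategoryTheory CategoryTheory.Limits AlgebraicGeometry MonoidalCategory CartesianMonoidalCategory
open Literature.AlgebraicGeometry.Motives (SchemeOver AbelianVariety IsProjectiveOver AlgPoints baseChange Corr)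
open Literature.NumberTheory.Automorphic.Liu2021.AppendixC (Nabla Albanese)
open scoped MonObj

namespace Literature.NumberTheory.Automorphic.Liu2021.Sec2AlbaneseVariety

universe u

variable {k : Type u} [Field k]

/-! ## §0. Carriers for the duality theory of abelian VARIETIES over `k` (used by Prop. 2.5, 2.7, 2.9, Rem. 2.6) -/

/-- ⟨CARRIER⟩ **Duality data for abelian varieties over `k`**, as used (not defined) in [Liu2021, §2.1]: «`θ_{f,D} : A^∨ → A`»
(Prop. 2.5, l. 1248), «`a ∈ A^∨(k′)` corresponding to a line bundle `L_a` on `A′`» (l. 1250), «`θ_{f,D}` is symmetric» (l. 1254),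
«`Alb_u^∨`» (Prop. 2.7, l. 1340), «is a polarization» (Prop. 2.9, l. 1383).  Fields: the dual `A ↦ A^∨` on ★ `Motives.AbelianVariety
k`, the dual homomorphism `f ↦ f^∨`, the relations «`θ : A^∨ → A` is symmetric» (`θ^∨ = θ` under `A ≅ A^∨∨`) and «`θ` is a
polarization».  The tree's HONEST versions of these notions live on abelian SCHEMES over a base (★ `AbelianSchemes.DualPair`,
★ `AbelianSchemes.Polarization`, Mumford–Fogarty–Kirwan Ch. 6, Milne I §8) — a different carrier (`AbelianSchemeOver S`), so
they are cited here, not bridged.  Types ∕ functions ∕ relations only; nothing asserted. [cite: Liu2021, Prop. 2.5 (p. 24),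
Prop. 2.7 (p. 27), Prop. 2.9 (p. 28); FJcycle.tex l. 1245–1255, 1337–1343, 1382–1384] -/
structure DualityCarriers (k : Type u) [Field k] where
  /-- ⟨CARRIER⟩ the dual abelian variety `A^∨`. -/
  dual : AbelianVariety k → AbelianVariety k
  /-- ⟨CARRIER⟩ the dual homomorphism `f^∨ : B^∨ → A^∨` of `f : A → B`. -/
  dualMap : {A B : AbelianVariety k} → (A ⟶ B) → (dual B ⟶ dual A)
  /-- ⟨CARRIER⟩ «`θ : A^∨ → A` is symmetric». -/
  IsSymm : {A : AbelianVariety k} → (dual A ⟶ A) → Prop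
  /-- ⟨CARRIER⟩ «`θ : A^∨ → A` is a polarization». -/
  IsPolarization : {A : AbelianVariety k} → (dual A ⟶ A) → Prop

/-! ## §1. Def. 2.1 (2): the set `X(π₀(X_{k′}))` (REAL), and the hypothesis structure `Sec2Data` -/

/-- D. **`X(π₀(X_{k′}))`** (Def. 2.1 (2), l. 1176: «For such `k′`, we regard `π₀(X_{k′})` as a scheme in `Sch_{/k′}` … In particular,
giving an element in `X(π₀(X_{k′}))` is equivalent to giving an element in `X_i(k′)` for every connected component `X_i` of `X_{k′}`»):
a `k′`-point of `X_{k′} = X ×_k k′` (★ `Motives.baseChange`, ★ `AlgPoints`) on EVERY connected component (Mathlib `ConnectedComponents`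
of the underlying space) — REAL. [cite: Liu2021, Def. 2.1 (2) (p. 22); FJcycle.tex l. 1176] -/
def CompPoint (X : SchemeOver k) (k' : Type u) [Field k'] [Algebra k k'] : Type u :=
  { x : _root_.ConnectedComponents ↥((baseChange k k').obj X).left → AlgPoints ((baseChange k k').obj X) k' //
      ∀ c, _root_.ConnectedComponents.mk (x c).pt = c }

/-- **Hypothesis structure for [Liu2021, §2]** on ONE proper smooth `k`-scheme `X` of pure dimension `d` with a chosen Albanese datum.
REAL fields: `isProper`, `smooth` (Mathlib), `alb : ★ Albanese X` (Prop. 2.2 ∕ Def. 2.3 as typed in ★ `AppendixC/Glue`).  ⟨CARRIER⟩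
fields (printed notions Mathlib ∕ the tree lack for a possibly disconnected `X`), meanings VERBATIM:
* `Div`, `zsmulDiv n D = nD`, `RatEquiv` — divisors on `X`, multiples, rational equivalence (Prop. 2.5, l. 1246, 1254);
* `Splits k′` — «a field `k′` over `k` splits `X` if every connected component of `X_{k′}` is geometrically connected» (Def. 2.1 (2));
* `fx f k′ x` — «`f_x : X_{k′} → Y_{k′}` the morphism such that its restriction to a connected component `X_i` is the restriction of
  `f_{k′}` to `X_i ×_{k′} (x ∩ X_i) ≃ X_i`» for `f : ∇X → Y` (Def. 2.1 (3), l. 1178–1182), typed for `Y = A` an abelian variety;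
* `theta A f hf D` — «`θ_{f,D} : A^∨ → A`» for `f ∈ \underline{Alb}_X(A)` (= `f : ∇X → A` with `ΔX ⊆ f⁻¹ 0_A`, read `ΔX ≫ f = 1` as in ★
  `Albanese`) and a divisor `D` (Prop. 2.5);
* `thetaValue A f hf D k′ x a` — the point «`Σ_{A′}(c₁(L_a).f_{x*}(D^{dim X−1}))` ∈ A(k′)», `Σ_{A′} : CH₀(A′) → A(k′)` the classical
  Albanese map, `L_a` the line bundle of `a ∈ A^∨(k′)` (Prop. 2.5, l. 1250–1254);
* `BasePointFree D`, `GenFiniteOntoImage D` — «`|D|` is base point free», «the induced morphism `φ_D : X → ℙ(|D|)` is a generically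
  finite morphism onto its image» (Def. 2.8);
* `Comp`, `degTop D c` — irreducible (= connected, `X` smooth) components of `X` and «the degree of the top intersection `deg D^{dim X}`»
  on the component `c` (Rem. 2.10; §2.2 l. 1445 «`deg D^d` … as a function on `π₀(X)`»);
* `picardCorrespondence D` — «`e_{X,D} := E_{X,D} / (n (deg D^d)²) ∈ CH^d(X × X)_ℚ`», `E_{X,D} := p_{24*}(β^* c₁(𝒫).(D^d × X × D^d ×
  D^{d−1}))`, `β := (ϑ ∘ α_X) × α_X : ∇X × ∇X → Alb_X^∨ × Alb_X`, `θ ∘ ϑ = [n]_{Alb_X}`, `𝒫` the Poincaré bundle (§2.2, l. 1433–1445; «does not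
  depend on the choice of `ϑ`», exercise l. 1445) — valued in the REAL ★ `Corr X X d = CH_d(X ×_k X)_ℚ` (= `CH^d` for `X` of pure
  dimension `d`); meaningful for `D` almost ample;
* `HdR i`, `clStar z i` — «`H^i_dR(X/k)`» and the degree-`i` component of «the induced endomorphism `cl*_dR(z)`» of `⊕_i H^i_dR(X/k)` for
  `z ∈ CH^d(X × X)_ℚ` (§2.2, l. 1427–1431; §3.1);
* `H1et ℓ`, `galH1et ℓ`, `etalePull ℓ` — «`H¹_ét(X_{k^ac}, ℚ_ℓ)`» as a `Gal(k^ac/k)`-module and the map `α″_X : H¹_ét((Alb_X)_{k^ac}, ℚ_ℓ) →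
  H¹_ét(X_{k^ac}, ℚ_ℓ)` of the proof of Lem. 2.4 (2) (l. 1230–1238: `α′_X` extends `α_X` by `0` off `∇X`, Künneth, cup product with `H⁰`),
  whose SOURCE is REAL: `H¹_ét` of the abelian variety `Alb_X` = `ℚ_ℓ`-dual of its rational Tate module (★ `AbelianVariety.rationalTateModule`
  ∕ `rationalTateRep`, [Milne AV, Thm. 15.1 (a)], the reading of ★ `AppendixC/EtaleH1Tower`).
No propositional field; nothing asserted. [cite: Liu2021, Def. 2.1 (p. 22), Prop. 2.5 (p. 24), Def. 2.8 (p. 28), Rem. 2.10 (p. 29),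
§2.2 (pp. 29–30); FJcycle.tex l. 1171–1184, 1245–1255, 1377–1379, 1415–1417, 1427–1445] -/
structure Sec2Data (X : SchemeOver k) (d : ℕ) (𝔇 : DualityCarriers k) where
  /-- «proper» (l. 1191): `X → Spec k` is proper (Mathlib). -/
  isProper : IsProper X.hom
  /-- «smooth» of pure dimension `d` (l. 1191, 1427): Mathlib `SmoothOfRelativeDimension d`. -/
  smooth : SmoothOfRelativeDimension d X.hom
  /-- REAL: the Albanese datum `(∇X, Alb_X, α_X)` of ★ `AppendixC.Albanese` (Prop. 2.2, Def. 2.3). -/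
  alb : Albanese X
  /-- ⟨CARRIER⟩ divisors on `X`. -/
  Div : Type u
  /-- ⟨CARRIER⟩ `nD` for `n ∈ ℤ` (Prop. 2.5, l. 1254). -/
  zsmulDiv : ℤ → Div → Div
  /-- ⟨CARRIER⟩ rational equivalence of divisors (Prop. 2.5: «depends only on the rational equivalence class of `D`»). -/
  RatEquiv : Div → Div → Prop
  /-- ⟨CARRIER⟩ «`k′` splits `X`» (Def. 2.1 (2)). -/
  Splits : (k' : Type u) → [Field k'] → [Algebra k k'] → Prop
  /-- ⟨CARRIER⟩ `f_x : X_{k′} → A_{k′}` (Def. 2.1 (3)) for `f : ∇X → A`, `x ∈ X(π₀(X_{k′}))`. -/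
  fx : {A : AbelianVariety k} → (alb.nabla.N ⟶ A.X) → (k' : Type u) → [Field k'] → [Algebra k k'] → CompPoint X k' →
    ((baseChange k k').obj X ⟶ (baseChange k k').obj A.X)
  /-- ⟨CARRIER⟩ `θ_{f,D} : A^∨ → A` (Prop. 2.5). -/
  theta : (A : AbelianVariety k) → (f : alb.nabla.N ⟶ A.X) → alb.nabla.diag ≫ f = 1 → Div → (𝔇.dual A ⟶ A)
  /-- ⟨CARRIER⟩ the point `Σ_{A′}(c₁(L_a).f_{x*}(D^{dim X−1})) ∈ A(k′)` (Prop. 2.5). -/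
  thetaValue : (A : AbelianVariety k) → (f : alb.nabla.N ⟶ A.X) → alb.nabla.diag ≫ f = 1 → Div →
    (k' : Type u) → [Field k'] → [Algebra k k'] → CompPoint X k' → (𝔇.dual A).Points k' → A.Points k'
  /-- ⟨CARRIER⟩ «`|D|` is base point free» (Def. 2.8). -/
  BasePointFree : Div → Prop
  /-- ⟨CARRIER⟩ «`φ_D : X → ℙ(|D|)` is a generically finite morphism onto its image» (Def. 2.8). -/
  GenFiniteOntoImage : Div → Prop
  /-- ⟨CARRIER⟩ irreducible components of `X` (Rem. 2.10; `π₀(X)`, l. 1342, 1445). -/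
  Comp : Type u
  /-- ⟨CARRIER⟩ `deg D^{dim X}` on the component `c` (Rem. 2.10, l. 1416; l. 1445). -/
  degTop : Div → Comp → ℤ
  /-- ⟨CARRIER⟩ `e_{X,D} ∈ CH^d(X × X)_ℚ` (§2.2, l. 1443), in ★ `Corr X X d`. -/
  picardCorrespondence : Div → Corr X X d
  /-- ⟨CARRIER⟩ `H^i_dR(X/k)` (l. 1429). -/
  HdR : ℕ → ModuleCat.{u} k
  /-- ⟨CARRIER⟩ the `H^i_dR`-component of `cl*_dR(z)` for `z ∈ CH^d(X × X)_ℚ` (l. 1429). -/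
  clStar : Corr X X d → (i : ℕ) → (HdR i ⟶ HdR i)
  /-- ⟨CARRIER⟩ `H¹_ét(X_{k^ac}, ℚ_ℓ)` (Lem. 2.4 (2)). -/
  H1et : (ℓ : ℕ) → [Fact ℓ.Prime] → ModuleCat.{u} ℚ_[ℓ]
  /-- ⟨CARRIER⟩ the `Gal(k^ac/k)`-action on `H¹_ét(X_{k^ac}, ℚ_ℓ)` (Lem. 2.4 (2)). -/
  galH1et : (ℓ : ℕ) → [Fact ℓ.Prime] → Representation ℚ_[ℓ] (Field.absoluteGaloisGroup k) (H1et ℓ)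
  /-- ⟨CARRIER⟩ the comparison map `α″_X : H¹_ét((Alb_X)_{k^ac}, ℚ_ℓ) → H¹_ét(X_{k^ac}, ℚ_ℓ)` (proof of Lem. 2.4 (2), l. 1237); source REAL. -/
  etalePull : (ℓ : ℕ) → [Fact ℓ.Prime] → (Module.Dual ℚ_[ℓ] (alb.Alb.rationalTateModule ℓ) →ₗ[ℚ_[ℓ]] H1et ℓ)

namespace Sec2Data

variable {X : SchemeOver k} {d : ℕ} {𝔇 : DualityCarriers k} (S : Sec2Data X d 𝔇)

/-! ### Class D: definitions read off the print -/

/-- D. **`\underline{Alb}_X(A)`** (Prop. 2.2, l. 1191: «the set of morphisms `f : ∇X → A` over `k` such that `ΔX` is contained in `f⁻¹0_A`»),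
read as in ★ `Albanese`: `ΔX ≫ f` is the unit `X`-valued point of `A`. [cite: Liu2021, Prop. 2.2 (p. 23); FJcycle.tex l. 1191] -/
def AlbHom (A : AbelianVariety k) : Type u :=
  { f : S.alb.nabla.N ⟶ A.X // S.alb.nabla.diag ≫ f = 1 }

/-- D. **`θ_{X,D} := θ_{α_X,D} : Alb_X^∨ → Alb_X`** (l. 1326–1329: «In the case where `(A,f) = (Alb_X, α_X)`, we will simply write
`θ_{X,D} := θ_{α_X,D}`»). [cite: Liu2021, §2.1 (p. 26), display before Rem. 2.6; FJcycle.tex l. 1326–1329] -/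
def thetaX (D : S.Div) : 𝔇.dual S.alb.Alb ⟶ S.alb.Alb :=
  S.theta S.alb.Alb S.alb.α S.alb.diag_α D

/-- D. **Definition 2.8 (almost ample)**, AS PRINTED: «We say that a divisor `D` on a proper smooth scheme `X` over `k` is almost ample
if there exists `m ∈ ℤ_{>0}` such that `|mD|` is base point free and that the induced morphism `φ_{mD} : X → ℙ(|mD|)` is a generically
finite morphism onto its image.» [cite: Liu2021, Def. 2.8 (p. 28); FJcycle.tex l. 1377–1379] -/
def IsAlmostAmple (D : S.Div) : Prop :=
  ∃ m : ℤ, 0 < m ∧ S.BasePointFree (S.zsmulDiv m D) ∧ S.GenFiniteOntoImage (S.zsmulDiv m D)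

/-! ### Class P: Lem. 2.4 (2), Proposition 2.5 (five clauses), Rem. 2.6, Prop. 2.9, Rem. 2.10, Prop. 2.12 (1) -/

/-- P. **Lemma 2.4 (2)**, AS PRINTED: «Suppose that `k` has characteristic zero. Then … (2) for every prime `ℓ`, we have a canonical
isomorphism `H¹_ét((Alb_X)_{k^ac}, ℚ_ℓ) ≃ H¹_ét(X_{k^ac}, ℚ_ℓ)` of `Gal(k^ac/k)`-modules.»  Typed on the map `α″_X` of the printed proof
(`S.etalePull`): it is bijective and `Gal(k^ac/k)`-equivariant, the Galois action on `H¹_ét` of the abelian variety `Alb_X` being the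
contragredient (Mathlib `Representation.dual`) of ★ `AbelianVariety.rationalTateRep` (`Field.absoluteGaloisGroup k`; `k^sep = k^ac` in
characteristic zero).  Part (1) is ★ `albanese_bettiOne_pullback_bijective` (cited, not restated).  Nothing asserted.
[cite: Liu2021, Lem. 2.4 (2) (p. 23) with proof (p. 23–24); FJcycle.tex l. 1215, 1230–1239] [cite: Milne1986AbelianVarieties, Thm 15.1 (a)] -/
def Lem24_2 : Prop :=
  CharZero k → ∀ (ℓ : ℕ) [Fact ℓ.Prime], Function.Bijective (S.etalePull ℓ) ∧
    ∀ (σ : Field.absoluteGaloisGroup k) (v : Module.Dual ℚ_[ℓ] (S.alb.Alb.rationalTateModule ℓ)),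
      S.etalePull ℓ ((S.alb.Alb.rationalTateRep ℓ).dual σ v) = S.galH1et ℓ σ (S.etalePull ℓ v)


/-- P. **Proposition 2.5, defining property**, AS PRINTED: «For every `f ∈ \underline{Alb}_X(A)` and every divisor `D` on `X`, there is
a unique homomorphism `θ_{f,D} : A^∨ → A` (over `k`) satisfying the following property: for every field `k′` over `k`, every geometric
point `a` of `A^∨(k′)` corresponding to a line bundle `L_a` on `A′ := A_{k′}`, and every element `x ∈ X(π₀(X_{k′}))`, we have
`θ_{f,D}(a) = Σ_{A′}(c₁(L_a).f_{x*}(D^{dim X−1}))`, where `Σ_{A′} : CH₀(A′) → A(k′)` is the (classical) Albanese map for `A′`.»  Typed: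
the posited `θ_{f,D}` (`S.theta`) sends every `k′`-point `a` of `A^∨` (★ `AlgPoints.map` along the underlying scheme morphism) to
the posited value, for every `k′` that splits `X` (so that `f_x` is defined, Def. 2.1 (3)) and every `x`; `dim X − 1 = d − 1` with
`1 ≤ d`.  Existence part of the printed «there is a unique»: `S.theta` is DATA; uniqueness is `Prop25_unique`.  Nothing asserted.
[cite: Liu2021, Prop. 2.5 (p. 24); FJcycle.tex l. 1245–1254] -/
def Prop25_formula : Prop :=
  1 ≤ d → ∀ (A : AbelianVariety k) (f : S.alb.nabla.N ⟶ A.X) (hf : S.alb.nabla.diag ≫ f = 1) (D : S.Div)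
    (k' : Type u) [Field k'] [Algebra k k'], S.Splits k' → ∀ (x : CompPoint X k') (a : (𝔇.dual A).Points k'),
      AlgPoints.map (S.theta A f hf D).hom.hom.hom a = S.thetaValue A f hf D k' x a

/-- P. **Proposition 2.5, uniqueness**: «there is a UNIQUE homomorphism `θ_{f,D} : A^∨ → A` … satisfying the [pointwise] property»
— any homomorphism with the property is `θ_{f,D}`. [cite: Liu2021, Prop. 2.5 (p. 24); FJcycle.tex l. 1246–1253] -/
def Prop25_unique : Prop :=
  1 ≤ d → ∀ (A : AbelianVariety k) (f : S.alb.nabla.N ⟶ A.X) (hf : S.alb.nabla.diag ≫ f = 1) (D : S.Div)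
    (θ' : 𝔇.dual A ⟶ A),
    (∀ (k' : Type u) [Field k'] [Algebra k k'], S.Splits k' → ∀ (x : CompPoint X k') (a : (𝔇.dual A).Points k'),
        AlgPoints.map θ'.hom.hom.hom a = S.thetaValue A f hf D k' x a) →
      θ' = S.theta A f hf D

/-- P. **Proposition 2.5, «Moreover, `θ_{f,D}` is symmetric»**. [cite: Liu2021, Prop. 2.5 (p. 24); FJcycle.tex l. 1254] -/
def Prop25_symm : Prop :=
  ∀ (A : AbelianVariety k) (f : S.alb.nabla.N ⟶ A.X) (hf : S.alb.nabla.diag ≫ f = 1) (D : S.Div), 𝔇.IsSymm (S.theta A f hf D)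

/-- P. **Proposition 2.5, «depends only on the rational equivalence class of `D`»**. [cite: Liu2021, Prop. 2.5 (p. 24); FJcycle.tex l. 1254] -/
def Prop25_ratEquiv : Prop :=
  ∀ (A : AbelianVariety k) (f : S.alb.nabla.N ⟶ A.X) (hf : S.alb.nabla.diag ≫ f = 1) (D D' : S.Div),
    S.RatEquiv D D' → S.theta A f hf D = S.theta A f hf D'

/-- P. **Proposition 2.5, «and satisfies `θ_{f,nD} = [n^{dim X−1}]_A ∘ θ_{f,D}` for `n ∈ ℤ`»** (`[m]_A = m • 𝟙 A` in the additive group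
of endomorphisms of the ★ abelian variety `A`; `∘` = apply `θ_{f,D}` first). [cite: Liu2021, Prop. 2.5 (p. 24); FJcycle.tex l. 1254] -/
def Prop25_smul : Prop :=
  1 ≤ d → ∀ (A : AbelianVariety k) (f : S.alb.nabla.N ⟶ A.X) (hf : S.alb.nabla.diag ≫ f = 1) (D : S.Div) (n : ℤ),
    S.theta A f hf (S.zsmulDiv n D) = S.theta A f hf D ≫ ((n ^ (d - 1) : ℤ) • 𝟙 A)

/-- P. **Remark 2.6**, AS PRINTED: «If `dim X = 1`, then `θ_{X,D}` is the canonical polarization of `Alb_X` (which is simply the Jacobian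
of `X`), hence is an isomorphism and is independent of `D`.»  Typed as: `θ_{X,D}` is a polarization, an isomorphism, and independent of
`D` («canonical polarization of the Jacobian» itself is not typed). [cite: Liu2021, Rem. 2.6 (p. 26); FJcycle.tex l. 1331–1333] -/
def Rem26 : Prop :=
  d = 1 → ∀ D D' : S.Div, 𝔇.IsPolarization (S.thetaX D) ∧ IsIso (S.thetaX D) ∧ S.thetaX D = S.thetaX D'

/-- P. **Proposition 2.9**, AS PRINTED: «Suppose that `k` has characteristic zero. Let `X` be a proper smooth scheme in `Sch_{/k}` and `D` a
divisor on `X` such that `D` is almost ample. Then the symmetric homomorphism `θ_{X,D} : Alb_X^∨ → Alb_X` is a polarization.»  Printed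
proof: Lefschetz principle, `k = ℂ`, positivity of `∫ ω ∧ ω̄ ∧ f_* c₁(D)^{d−1}` via a semi-positive metric on `𝒪_X(D)`.  Nothing asserted.
[cite: Liu2021, Prop. 2.9 (p. 28); FJcycle.tex l. 1382–1413] -/
def Prop29 : Prop :=
  CharZero k → ∀ D : S.Div, S.IsAlmostAmple D → 𝔇.IsPolarization (S.thetaX D)

/-- P. **Remark 2.10**, AS PRINTED: «There is a byproduct in proof of Proposition 2.9: For an almost ample divisor `D` on a proper smooth
scheme `X` over a field `k` of characteristic zero, the degree of the top intersection `deg D^{dim X}` is strictly positive on every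
irreducible component of `X`.» [cite: Liu2021, Rem. 2.10 (p. 29); FJcycle.tex l. 1415–1417] -/
def Rem210 : Prop :=
  CharZero k → ∀ D : S.Div, S.IsAlmostAmple D → ∀ c : S.Comp, 0 < S.degTop D c

/-- P. **Proposition 2.12 (1)**, AS PRINTED (§2.2: `k` of characteristic zero, `X` of pure dimension `d ≥ 1`, `D` almost ample): «The map
`cl*_dR(e_{X,D})` coincides with the projection to `H¹_dR(X/k)`» — on `⊕_{i=0}^{2d} H^i_dR(X/k)` (l. 1429): identity on `H¹_dR`, zero on
`H^i_dR` for `i ≠ 1`. [cite: Liu2021, Prop. 2.12 (1) (p. 30) with §2.2 l. 1427–1431; FJcycle.tex l. 1448–1451] -/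
def Prop212_1 : Prop :=
  CharZero k → 1 ≤ d → ∀ D : S.Div, S.IsAlmostAmple D →
    S.clStar (S.picardCorrespondence D) 1 = 𝟙 (S.HdR 1) ∧ ∀ i : ℕ, i ≠ 1 → S.clStar (S.picardCorrespondence D) i = 0

end Sec2Data

/-! ## §2. Two schemes: Prop. 2.7 and Prop. 2.12 (2) (functoriality along `u : Y → X`) -/

/-- **Hypothesis structure for the functoriality statements** Prop. 2.7 and Prop. 2.12 (2): §2 data for `X` AND for `Y` (both proper
smooth of pure dimension `d`, the same duality carriers `𝔇`), and ⟨CARRIER⟩ fields for the printed operations along a morphism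
`u : Y → X`: the relation «`u` is a generically finite dominant morphism» (Prop. 2.7, l. 1338), the pull-back of divisors `u*D`
(l. 1340), the endomorphism «`[deg u]_{Alb_X}` … `deg u` is regarded as a function on `π₀(X)` whose value on a connected component of
`X` is the total degree of `u` over it; and if we write `X = ∐ X_i`, then `[deg u]_{Alb_X}` is the endomorphism `∏_i [(deg u)(X_i)]_{Alb_{X_i}}`
on `Alb_X ≃ ∏_i Alb_{X_i}`» (l. 1342), and the maps `(id_Y × u)_* : CH^d(Y × Y)_ℚ → CH^d(Y × X)_ℚ`, `(u × id_X)^* : CH^d(X × X)_ℚ →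
CH^d(Y × X)_ℚ` of Prop. 2.12 (2) (REAL targets ★ `Corr`).  `Alb_u` itself is REAL: ★ `Albanese.map`.  Nothing asserted.
[cite: Liu2021, Prop. 2.7 (p. 27), Prop. 2.12 (2) (p. 30); FJcycle.tex l. 1337–1343, 1453–1457] -/
structure Sec2PairData (X Y : SchemeOver k) (d : ℕ) (𝔇 : DualityCarriers k) where
  /-- §2 data for `X`. -/
  SX : Sec2Data X d 𝔇
  /-- §2 data for `Y`. -/
  SY : Sec2Data Y d 𝔇
  /-- ⟨CARRIER⟩ «`u : Y → X` is a generically finite dominant morphism» (l. 1338). -/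
  GenFiniteDominant : (Y ⟶ X) → Prop
  /-- ⟨CARRIER⟩ the pull-back divisor `u*D` on `Y` (l. 1340). -/
  pullDiv : (Y ⟶ X) → SX.Div → SY.Div
  /-- ⟨CARRIER⟩ the endomorphism `[deg u]_{Alb_X}` of `Alb_X` (l. 1340–1342). -/
  degEndo : (Y ⟶ X) → (SX.alb.Alb ⟶ SX.alb.Alb)
  /-- ⟨CARRIER⟩ `(id_Y × u)_* : CH^d(Y × Y)_ℚ → CH^d(Y × X)_ℚ` (l. 1455). -/
  pushIdProd : (Y ⟶ X) → Corr Y Y d → Corr Y X d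
  /-- ⟨CARRIER⟩ `(u × id_X)^* : CH^d(X × X)_ℚ → CH^d(Y × X)_ℚ` (l. 1455). -/
  pullProdId : (Y ⟶ X) → Corr X X d → Corr Y X d

namespace Sec2PairData

variable {X Y : SchemeOver k} {d : ℕ} {𝔇 : DualityCarriers k} (P : Sec2PairData X Y d 𝔇)

/-- P. **Proposition 2.7**, AS PRINTED: «Let `u : Y → X` be a generically finite dominant morphism of proper smooth schemes over `k`. Let
`D` be a divisor on `X`. Then we have `[deg u]_{Alb_X} ∘ θ_{X,D} = Alb_u ∘ θ_{Y,u*D} ∘ Alb_u^∨`.»  In composition order (apply right to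
left as printed): `θ_{X,D} ≫ [deg u]_{Alb_X} = (Alb_u)^∨ ≫ θ_{Y,u*D} ≫ Alb_u`, with `Alb_u` = ★ `Albanese.map`.  Nothing asserted.
[cite: Liu2021, Prop. 2.7 (p. 27); FJcycle.tex l. 1337–1343] -/
def Prop27 : Prop :=
  ∀ (u : Y ⟶ X), P.GenFiniteDominant u → ∀ D : P.SX.Div,
    P.SX.thetaX D ≫ P.degEndo u =
      𝔇.dualMap (P.SY.alb.map P.SX.alb u) ≫ P.SY.thetaX (P.pullDiv u D) ≫ (P.SY.alb.map P.SX.alb u)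

/-- P. **Proposition 2.12 (2)**, AS PRINTED (`k` of characteristic zero, `X` of pure dimension `d ≥ 1`, `D` almost ample on `X`): «Let
`u : Y → X` be a generically finite dominant morphism of proper smooth schemes over `k`. Then `u*D` is an almost ample divisor on `Y`, and
we have `(id_Y × u)_* e_{Y,u*D} = (u × id_X)^* e_{X,D}` in `CH^d(Y × X)_ℚ`.»  Nothing asserted.
[cite: Liu2021, Prop. 2.12 (2) (p. 30); FJcycle.tex l. 1453–1457] -/
def Prop212_2 : Prop :=
  CharZero k → 1 ≤ d → ∀ (u : Y ⟶ X), P.GenFiniteDominant u → ∀ D : P.SX.Div, P.SX.IsAlmostAmple D →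
    P.SY.IsAlmostAmple (P.pullDiv u D) ∧
      P.pushIdProd u (P.SY.picardCorrespondence (P.pullDiv u D)) = P.pullProdId u (P.SX.picardCorrespondence D)

end Sec2PairData

end Literature.NumberTheory.Automorphic.Liu2021.Sec2AlbaneseVariety

end
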